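import Literature.RingTheory.MvPolynomial.Directrix
import Mathlib.Algebra.MvPolynomial.PDeriv
import HarnessLib

/-!
# The coefficient kit of `linForm : (Fin n → K) →ₗ[K] K[X₁,…,Xₙ]`

`Literature/RingTheory/MvPolynomial/DirectrixLinForm.lean` (HIRONAKA-L discharge lane, librarian
res-D-lib-2, dedupe hoist; DEF-FREE). `Literature.RingTheory.MvPolynomial.linForm v = Σ_i v_i X_i`
(`Directrix.lean`, the linear forms as coefficient vectors — CJS' identification of the degree-one
piece `S_1 = 𝔪/𝔪²` of the graded ring of a regular local ring with `kⁿ`, in which the directrix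
`Dir(C_x X) ⊆ T_x(Z)` and the directing spaces `𝒯(I) ⊆ S_1` live
[cite: CossartJannsenSaito2020, Def. 2.5, Lemma 2.7, Def. 2.18]) comes with `linForm_apply`,
`linForm_single`, `range_linForm`, `linForm_injective`, `isHomogeneous_linForm`,
`map_comap_linForm`. This file adds the COEFFICIENT identities every consumer re-derived privately
(librarian census 2026-08-27T12:2xZ: `coeff_single(_one)_linForm` ×9 files, `eq_linForm_coeff` ×5,
`linForm_sum_smul` ×2, `linForm_eq_sum_C_mul` ×2, `pderiv_linForm`, `linForm_eq_zero_iff`, …):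

* `coeff_single_one_linForm`: the `X_i`-coefficient of `Σ v_j X_j` is `v_i`;
  `coeff_linForm_eq_zero_of_degree_ne_one`, `constantCoeff_linForm`;
* `eq_linForm_coeff`: a form of degree `1` IS the linear form of its `X_i`-coefficients;
  `exists_eq_linForm_of_mem`, `linForm_mem_homogeneousSubmodule_one`,
  `mem_homogeneousSubmodule_one_iff_exists_linForm`;
* `linForm_eq_sum_C_mul`, `linForm_sum_smul`, `linForm_eq_zero_iff`, `linForm_ne_zero_iff`;
* `eval_linForm_eq` (`(Σ v_i X_i)(x) = Σ v_i x_i`, any `n`; the `Fin (N+1)` twin `eval_linForm` is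
  in `CubicFormPlaneChains.lean`), `aeval_linForm_eq`;
* `pderiv_linForm` (`∂_i (Σ v_j X_j) = v_i`), `totalDegree_linForm_le`.

Not here: `linSubst_linForm` (the action of a linear substitution, which needs
`HilbertSamuel/TangentConeChangeOfGenerators.lean`).
-/

noncomputable section

open MvPolynomial Finset

open scoped BigOperators

namespace Literature.RingTheory.MvPolynomial

variable {K : Type*} [Field K] {n : ℕ}

/-! ## Coefficients -/

/-- **The `X_i`-coefficient of the linear form `Σ_j v_j X_j` is `v_i`.**
[cite: CossartJannsenSaito2020, Def. 2.18 (S_1 = ⊕ k·X_i, coordinates of a linear form)] -/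
theorem coeff_single_one_linForm (v : Fin n → K) (i : Fin n) :
    coeff (Finsupp.single i 1) (linForm v) = v i := by
  classical
  rw [linForm_apply, coeff_sum]
  simp_rw [coeff_smul, coeff_X, smul_eq_mul]
  rw [Finset.sum_eq_single i]
  · rw [if_pos rfl, mul_one]
  · intro j _ hj
    rw [if_neg, mul_zero]
    exact fun h => hj (Finsupp.single_left_injective one_ne_zero h)
  · exact fun h => absurd (Finset.mem_univ i) h

/-- A coefficient of `Σ_j v_j X_j` at an exponent of degree `≠ 1` vanishes.
[cite: CossartJannsenSaito2020, Def. 2.18 (S_1, the forms of degree one)] -/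
theorem coeff_linForm_eq_zero_of_degree_ne_one (v : Fin n → K) {d : Fin n →₀ ℕ} (hd : d.degree ≠ 1) :
    coeff d (linForm v) = 0 :=
  (isHomogeneous_linForm v).coeff_eq_zero hd

/-- A linear form has no constant term. [cite: CossartJannsenSaito2020, Def. 2.18 (S_1, the forms of degree one)] -/
theorem constantCoeff_linForm (v : Fin n → K) : constantCoeff (linForm v) = 0 := by
  show coeff 0 (linForm v) = 0
  exact coeff_linForm_eq_zero_of_degree_ne_one v (by rw [map_zero]; exact zero_ne_one)

/-! ## Degree-one forms are linear forms of their coefficients -/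

/-- `linForm v` is a form of degree `1` (membership form of `isHomogeneous_linForm`).
[cite: CossartJannsenSaito2020, Def. 2.18 (S_1, the forms of degree one)] -/
theorem linForm_mem_homogeneousSubmodule_one (v : Fin n → K) :
    linForm v ∈ homogeneousSubmodule (Fin n) K 1 :=
  (mem_homogeneousSubmodule 1 _).mpr (isHomogeneous_linForm v)

/-- A form of degree `1` is `linForm` of some coefficient vector. [cite: CossartJannsenSaito2020, Def. 2.18 (S_1 ≅ kⁿ)] -/
theorem exists_eq_linForm_of_mem {L : MvPolynomial (Fin n) K} (hL : L ∈ homogeneousSubmodule (Fin n) K 1) :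
    ∃ v : Fin n → K, L = linForm v := by
  have hL' : L ∈ LinearMap.range (linForm (K := K) (n := n)) := by rwa [range_linForm]
  obtain ⟨v, hv⟩ := hL'
  exact ⟨v, hv.symm⟩

/-- The degree-one forms are exactly the `linForm v`. [cite: CossartJannsenSaito2020, Def. 2.18 (S_1 ≅ kⁿ)] -/
theorem mem_homogeneousSubmodule_one_iff_exists_linForm {L : MvPolynomial (Fin n) K} :
    L ∈ homogeneousSubmodule (Fin n) K 1 ↔ ∃ v : Fin n → K, L = linForm v :=
  ⟨exists_eq_linForm_of_mem, by rintro ⟨v, rfl⟩; exact linForm_mem_homogeneousSubmodule_one v⟩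

/-- **A form of degree `1` is the linear form of its `X_i`-coefficients**: `L = Σ_i coeff_{e_i}(L) X_i`.
[cite: CossartJannsenSaito2020, Def. 2.18 (S_1 ≅ kⁿ, coordinates of a linear form)] -/
theorem eq_linForm_coeff {L : MvPolynomial (Fin n) K} (hL : L ∈ homogeneousSubmodule (Fin n) K 1) :
    L = linForm fun i => coeff (Finsupp.single i 1) L := by
  obtain ⟨v, rfl⟩ := exists_eq_linForm_of_mem hL
  congr 1
  funext i
  rw [coeff_single_one_linForm]

/-- Two linear forms with the same `X_i`-coefficients are equal (coefficient extensionality on `S_1`).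
[cite: CossartJannsenSaito2020, Def. 2.18 (S_1 ≅ kⁿ)] -/
theorem eq_of_mem_homogeneousSubmodule_one_of_coeff_eq {L L' : MvPolynomial (Fin n) K}
    (hL : L ∈ homogeneousSubmodule (Fin n) K 1) (hL' : L' ∈ homogeneousSubmodule (Fin n) K 1)
    (h : ∀ i, coeff (Finsupp.single i 1) L = coeff (Finsupp.single i 1) L') : L = L' := by
  rw [eq_linForm_coeff hL, eq_linForm_coeff hL']
  congr 1
  funext i
  exact h i

/-! ## Normal forms and linearity in the coefficient vector -/

/-- `linForm v = Σ_i C(v_i) · X_i`. [cite: CossartJannsenSaito2020, Def. 2.18 (S_1 = ⊕ k·X_i)] -/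
theorem linForm_eq_sum_C_mul (v : Fin n → K) :
    linForm v = ∑ i, C (v i) * (X i : MvPolynomial (Fin n) K) := by
  rw [linForm_apply]
  exact Finset.sum_congr rfl fun i _ => by rw [smul_eq_C_mul]

/-- `linForm` of a `k`-combination of coefficient vectors (sum form of linearity):
`linForm (i ↦ Σ_l r_l v_{l,i}) = Σ_l r_l • linForm v_l`. [cite: CossartJannsenSaito2020, Def. 2.18 (S_1 ≅ kⁿ is k-linear)] -/
theorem linForm_sum_smul {ι : Type*} (s : Finset ι) (r : ι → K) (v : ι → Fin n → K) :
    linForm (fun i => ∑ l ∈ s, r l * v l i) = ∑ l ∈ s, r l • linForm (v l) := by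
  have h : (fun i => ∑ l ∈ s, r l * v l i) = ∑ l ∈ s, r l • v l := by
    funext i
    simp [Finset.sum_apply, Pi.smul_apply, smul_eq_mul]
  rw [h, map_sum]
  exact Finset.sum_congr rfl fun l _ => by rw [map_smul]

/-- `linForm v = 0 ↔ v = 0`. [cite: CossartJannsenSaito2020, Def. 2.18 (S_1 ≅ kⁿ)] -/
theorem linForm_eq_zero_iff (v : Fin n → K) : linForm v = 0 ↔ v = 0 := by
  rw [← map_zero (linForm (K := K) (n := n))]
  exact linForm_injective.eq_iff

/-- `linForm v = 0` iff every coefficient vanishes. [cite: CossartJannsenSaito2020, Def. 2.18 (S_1 ≅ kⁿ)] -/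
theorem linForm_eq_zero_iff_forall (v : Fin n → K) : linForm v = 0 ↔ ∀ i, v i = 0 := by
  rw [linForm_eq_zero_iff, funext_iff]
  rfl

/-- `linForm v ≠ 0 ↔ v ≠ 0`. [cite: CossartJannsenSaito2020, Def. 2.18 (S_1 ≅ kⁿ)] -/
theorem linForm_ne_zero_iff (v : Fin n → K) : linForm v ≠ 0 ↔ v ≠ 0 :=
  (linForm_eq_zero_iff v).not

/-- `X_i` is the linear form of the `i`-th basis vector (the `symm` of `linForm_single`, stated for
rewriting occurrences of `X i`). [cite: CossartJannsenSaito2020, Def. 2.18 (S_1 = ⊕ k·X_i)] -/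
theorem X_eq_linForm_single (i : Fin n) : (X i : MvPolynomial (Fin n) K) = linForm (Pi.single i (1 : K)) :=
  (linForm_single i).symm

/-! ## Evaluation, substitution, partial derivatives, degree -/

/-- **Evaluation of a linear form**: `(Σ_i v_i X_i)(x) = Σ_i v_i x_i` (any number of variables; the
`Fin (N+1)` statement `eval_linForm` is in `CubicFormPlaneChains.lean`).
[cite: CossartJannsenSaito2020, Def. 2.18 (linear forms on T_x(Z) = Spec Sym 𝔪/𝔪²)] -/
theorem eval_linForm_eq (x v : Fin n → K) : eval x (linForm v) = ∑ i, v i * x i := by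
  rw [linForm_apply, map_sum]
  exact Finset.sum_congr rfl fun i _ => by rw [smul_eval, eval_X]

/-- Evaluation of a linear form in an algebra: `aeval x (Σ_i v_i X_i) = Σ_i v_i • x_i`.
[cite: CossartJannsenSaito2020, Def. 2.18 (linear forms on T_x(Z))] -/
theorem aeval_linForm_eq {S : Type*} [CommRing S] [Algebra K S] (x : Fin n → S) (v : Fin n → K) :
    aeval x (linForm v) = ∑ i, v i • x i := by
  rw [linForm_apply, map_sum]
  exact Finset.sum_congr rfl fun i _ => by rw [map_smul, aeval_X]

/-- **Partial derivatives of a linear form**: `∂_i (Σ_j v_j X_j) = C v_i`.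
[cite: CossartJannsenSaito2020, Def. 2.18 (S_1 ≅ kⁿ, coordinates of a linear form)] -/
theorem pderiv_linForm (i : Fin n) (v : Fin n → K) : pderiv i (linForm v) = C (v i) := by
  classical
  rw [linForm_eq_sum_C_mul, map_sum]
  simp_rw [Derivation.leibniz, pderiv_C, smul_zero, add_zero, pderiv_X, smul_eq_mul]
  rw [Finset.sum_eq_single i]
  · rw [Pi.single_eq_same, mul_one]
  · intro j _ hj
    rw [Pi.single_eq_of_ne hj, mul_zero]
  · exact fun h => absurd (Finset.mem_univ i) h

/-- A linear form has total degree `≤ 1`. [cite: CossartJannsenSaito2020, Def. 2.18 (S_1, the forms of degree one)] -/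
theorem totalDegree_linForm_le (v : Fin n → K) : (linForm v).totalDegree ≤ 1 :=
  (isHomogeneous_linForm v).totalDegree_le

/-- A non-zero linear form has total degree exactly `1`. [cite: CossartJannsenSaito2020, Def. 2.18 (S_1, the forms of degree one)] -/
theorem totalDegree_linForm {v : Fin n → K} (hv : v ≠ 0) : (linForm v).totalDegree = 1 :=
  (isHomogeneous_linForm v).totalDegree ((linForm_ne_zero_iff v).mpr hv)

end Literature.RingTheory.MvPolynomial
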